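import Mathlib.Analysis.Calculus.MeanValue
import Literature.Analysis.FluidPDE.CompressibleEulerProfileDerivativeDecay
import HarnessLib

/-!
# Sharp far-field asymptotics of the self-similar profile: `|U^{(k)}|, |S^{(k)}| ≲ ζ^{1−r−k}`
# (theorems only)

Topic `Literature/Analysis/FluidPDE`; namespace `Literature.Analysis.FluidPDE.CaolaboraEtAl2025`.
Sequel of `CompressibleEulerProfileDerivativeDecay.lean` (the weak bounds `ζ^{1−k}` from the
autonomous system in the logarithmic variable). THEOREMS ONLY, no new facts (D-0026).

Cao-Labora–Gómez-Serrano–Shi–Staffilani, eq. (1.6) (p. 6 of the held text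
`paper-arxiv-2310.05325`): the profiles satisfy `|∇ʲŪ| + |∇ʲS̄| ≲ ⟨ζ⟩^{1−r−j}` for all `j`.
In radial terms this is `|U^{(k)}(ζ)| + |S^{(k)}(ζ)| ≤ C_k ζ^{1−r−k}` for large `ζ`, and it
follows from the hypotheses of the vendored profile fact
`BuckmasterCaolaboraGomezserrano2025_thm11_monatomic` once `1 < r < 2` (the window of the fact is
`(1.10102, 1.13476)`): the point at infinity `P_∞ = (0,0)` of the autonomous system for
`(𝒰, 𝒮) = (U(e^ξ)/e^ξ, S(e^ξ)/e^ξ)` is a STAR NODE with linearisation `−r·Id`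
(`logOrbit_package`: `‖W(w) + r w‖ ≤ 16‖w‖²` near `0`), so the orbit, which is a priori
`O(e^{−ξ})` (`U`, `S` bounded, `exists_bound_profile`), is in fact `O(e^{−rξ})` by one bootstrap
(`ξ ↦ e^{rξ}(𝒰, 𝒮)` has integrable derivative `O(e^{(r−2)ξ})`; `logProfile_sharp`); the
iterated derivatives along the orbit are smooth functions of the position VANISHING at the
equilibrium, hence `O(‖(𝒰, 𝒮)‖) = O(e^{−rξ})` as well (`exists_lipschitz_iteratedDeriv_of_flow`,
`iteratedDeriv_logProfile_sharp`); and `U(ζ) = ζ𝒰(log ζ)` turns this into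
`|U^{(k)}(ζ)| ≤ C ζ^{1−r−k}` (`iteratedDeriv_le_of_rpow_mul_log_weight`,
`iteratedDeriv_profile_sharp`), together with the forms through `s = ζ²` needed for the fields
on `ℝ³` (`iteratedDeriv_profile_sqrt_sharp`).
[cite: CaolaboraEtAl2025, eq. (1.6) p. 6] [cite: BuckmasterCaolaboraGomezserrano2025, Thm 1.1 p. 4 (`P_∞`)]
-/

noncomputable section

open Set Filter Topology Metric
open scoped ContDiff

namespace Literature.Analysis.FluidPDE

open Literature.MathematicalPhysics.KineticTheory (V3)

namespace CaolaboraEtAl2025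

/-! ### Iterated derivatives along an orbit near an equilibrium -/

section Flow

variable {F : Type*} [NormedAddCommGroup F] [NormedSpace ℝ F]

/-- Along `y′ = W(y)`, `y^{(k)} = Φ_k(y)` with `Φ_k` smooth on the domain and `Φ_k(0) = 0` when
`W(0) = 0` (`Φ₀ = id`, `Φ_{k+1} = ∂Φ_k · W`). [folklore] -/
theorem exists_contDiffOn_iteratedDeriv_eq_zero {W : F → F} {O : Set F} (hO : IsOpen O)
    (hW : ContDiffOn ℝ ∞ W O) (hW0 : W 0 = 0) {y : ℝ → F} {a : ℝ}
    (hy : ∀ ξ, a < ξ → HasDerivAt y (W (y ξ)) ξ) (hyO : ∀ ξ, a < ξ → y ξ ∈ O) :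
    ∀ k : ℕ, ∃ Φ : F → F, ContDiffOn ℝ ∞ Φ O ∧ Φ 0 = 0 ∧
      ∀ ξ, a < ξ → iteratedDeriv k y ξ = Φ (y ξ)
  | 0 => ⟨id, contDiffOn_id, rfl, fun ξ _ => by simp⟩
  | k + 1 => by
    obtain ⟨Φ, hΦ, hΦ0, hk⟩ := exists_contDiffOn_iteratedDeriv_eq_zero hO hW hW0 hy hyO k
    refine ⟨fun p => fderiv ℝ Φ p (W p),
      (hΦ.fderiv_of_isOpen hO (by exact (rfl : (∞ : ℕ∞ω) + 1 = ∞).le)).clm_apply hW,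
      by simp [hW0], fun ξ hξ => ?_⟩
    have heq : iteratedDeriv k y =ᶠ[𝓝 ξ] fun η => Φ (y η) := by
      filter_upwards [Ioi_mem_nhds hξ] with η hη
      exact hk η hη
    have h1 : HasFDerivAt Φ (fderiv ℝ Φ (y ξ)) (y ξ) :=
      ((hΦ.differentiableOn (by simp)).differentiableAt (hO.mem_nhds (hyO ξ hξ))).hasFDerivAt
    have h2 : HasDerivAt (fun η => Φ (y η)) (fderiv ℝ Φ (y ξ) (W (y ξ))) ξ :=
      h1.comp_hasDerivAt ξ (hy ξ hξ)
    rw [iteratedDeriv_succ, heq.deriv_eq, h2.deriv]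

/-- **Derivatives along an orbit near an equilibrium are `O(‖y‖)`.** If `y′ = W(y)` for
`ξ > a`, `W` smooth on an open `O` with `W(0) = 0`, and `y(ξ)` stays in a compact convex
`K ⊆ O` containing `0`, then `‖y^{(k)}(ξ)‖ ≤ L_k ‖y(ξ)‖` (mean value inequality for `Φ_k`,
`Φ_k(0) = 0`). [folklore] -/
theorem exists_lipschitz_iteratedDeriv_of_flow {W : F → F} {O K : Set F} (hO : IsOpen O)
    (hW : ContDiffOn ℝ ∞ W O) (hW0 : W 0 = 0) (hK : IsCompact K) (hKc : Convex ℝ K)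
    (hKO : K ⊆ O) (h0K : (0 : F) ∈ K) {y : ℝ → F} {a : ℝ}
    (hy : ∀ ξ, a < ξ → HasDerivAt y (W (y ξ)) ξ) (hyK : ∀ ξ, a < ξ → y ξ ∈ K) (k : ℕ) :
    ∃ L, ∀ ξ, a < ξ → ‖iteratedDeriv k y ξ‖ ≤ L * ‖y ξ‖ := by
  obtain ⟨Φ, hΦ, hΦ0, hk⟩ :=
    exists_contDiffOn_iteratedDeriv_eq_zero hO hW hW0 hy (fun η hη => hKO (hyK η hη)) k
  have hcont : ContinuousOn (fderiv ℝ Φ) O := hΦ.continuousOn_fderiv_of_isOpen hO (by simp)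
  obtain ⟨L, hL⟩ := hK.exists_bound_of_continuousOn (hcont.mono hKO)
  refine ⟨L, fun ξ hξ => ?_⟩
  have hdiff : ∀ x ∈ K, DifferentiableAt ℝ Φ x := fun x hx =>
    (hΦ.differentiableOn (by simp)).differentiableAt (hO.mem_nhds (hKO hx))
  have h := hKc.norm_image_sub_le_of_norm_fderiv_le hdiff hL h0K (hyK ξ hξ)
  rw [hΦ0, sub_zero, sub_zero] at h
  rwa [hk ξ hξ]

end Flow

/-! ### Functions `s ↦ s^c h(b log s)` with weighted bounds on the derivatives of `h` -/

section RpowLogWeight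

/-- Weighted form of `iteratedDeriv_le_of_rpow_mul_log`: if `Ψ(s) = s^c h(b log s)` for
`s > s₀ > 0`, `b > 0`, with `h` smooth and `|h^{(m)}(η)| ≤ C_m wt(η)` on `(a, ∞)` for an
arbitrary weight `wt`, `a ≤ b log s₀`, then `|Ψ^{(k)}(s)| ≤ C_k s^{c−k} wt(b log s)` for `s > s₀`.
[folklore] -/
theorem iteratedDeriv_le_of_rpow_mul_log_weight {Ψ h wt : ℝ → ℝ} {a b c s₀ : ℝ} (hb : 0 < b)
    (hh : ContDiff ℝ ∞ h) (hbd : ∀ m : ℕ, ∃ C, ∀ η, a < η → |iteratedDeriv m h η| ≤ C * wt η)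
    (hs₀ : 0 < s₀) (has : a ≤ b * Real.log s₀)
    (hΨ : ∀ s, s₀ < s → Ψ s = s ^ c * h (b * Real.log s)) (k : ℕ) :
    ∃ C, ∀ s, s₀ < s → |iteratedDeriv k Ψ s| ≤ C * s ^ (c - k) * wt (b * Real.log s) := by
  have hlog : ∀ s, s₀ < s → a < b * Real.log s := fun s hs =>
    has.trans_lt (mul_lt_mul_of_pos_left (Real.log_lt_log hs₀ hs) hb)
  have key : ∀ k : ℕ, ∃ g : ℝ → ℝ, ContDiff ℝ ∞ g ∧
      (∀ m : ℕ, ∃ C, ∀ η, a < η → |iteratedDeriv m g η| ≤ C * wt η) ∧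
      ∀ s, s₀ < s → iteratedDeriv k Ψ s = s ^ (c - k) * g (b * Real.log s) := by
    intro k
    induction k with
    | zero => exact ⟨h, hh, hbd, fun s hs => by simpa using hΨ s hs⟩
    | succ k ih =>
      obtain ⟨g, hg, hgb, hfo⟩ := ih
      have hg' : ContDiff ℝ ∞ (deriv g) := (contDiff_infty_iff_deriv.1 hg).2
      refine ⟨fun η => b * deriv g η + (c - k) * g η,
        (contDiff_const.mul hg').add (contDiff_const.mul hg), fun m => ?_, fun s hs => ?_⟩
      · obtain ⟨C₁, hC₁⟩ := hgb (m + 1)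
        obtain ⟨C₀, hC₀⟩ := hgb m
        refine ⟨|b| * C₁ + |c - (k : ℝ)| * C₀, fun η hη => ?_⟩
        have e1 : iteratedDeriv m (fun η => b * deriv g η + (c - k) * g η) η =
            b * iteratedDeriv (m + 1) g η + (c - k) * iteratedDeriv m g η := by
          have ha : ContDiffAt ℝ m (fun η => b * deriv g η) η :=
            ((contDiff_const.mul hg').of_le (by exact_mod_cast le_top)).contDiffAt
          have hb' : ContDiffAt ℝ m (fun η => (c - (k : ℝ)) * g η) η :=
            ((contDiff_const.mul hg).of_le (by exact_mod_cast le_top)).contDiffAt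
          have := iteratedDeriv_add ha hb'
          rw [show ((fun η => b * deriv g η) + fun η => (c - (k : ℝ)) * g η) =
            fun η => b * deriv g η + (c - k) * g η from rfl] at this
          rw [this, iteratedDeriv_const_mul _ ((hg'.of_le (by exact_mod_cast le_top)).contDiffAt),
            iteratedDeriv_const_mul _ ((hg.of_le (by exact_mod_cast le_top)).contDiffAt),
            ← iteratedDeriv_succ']
        rw [e1]
        calc |b * iteratedDeriv (m + 1) g η + (c - ↑k) * iteratedDeriv m g η|
            ≤ |b * iteratedDeriv (m + 1) g η| + |(c - ↑k) * iteratedDeriv m g η| := abs_add_le _ _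
          _ ≤ |b| * (C₁ * wt η) + |c - (k : ℝ)| * (C₀ * wt η) := by
            rw [abs_mul, abs_mul]
            exact add_le_add (mul_le_mul_of_nonneg_left (hC₁ η hη) (abs_nonneg _))
              (mul_le_mul_of_nonneg_left (hC₀ η hη) (abs_nonneg _))
          _ = (|b| * C₁ + |c - (k : ℝ)| * C₀) * wt η := by ring
      · have hs0 : 0 < s := hs₀.trans hs
        have heq : iteratedDeriv k Ψ =ᶠ[𝓝 s] fun σ => σ ^ (c - k) * g (b * Real.log σ) := by
          filter_upwards [Ioi_mem_nhds hs] with σ hσ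
          exact hfo σ hσ
        have d1 : HasDerivAt (fun σ => σ ^ (c - (k : ℝ)))
            ((c - (k : ℝ)) * s ^ (c - (k : ℝ) - 1)) s := by
          simpa using Real.hasDerivAt_rpow_const (p := c - (k : ℝ)) (Or.inl hs0.ne')
        have d2 : HasDerivAt (fun σ => g (b * Real.log σ)) (deriv g (b * Real.log s) * (b * s⁻¹)) s :=
          ((hg.differentiable (by simp) _).hasDerivAt).comp s
            ((Real.hasDerivAt_log hs0.ne').const_mul b)
        have d3 : HasDerivAt (fun σ => σ ^ (c - (k : ℝ)) * g (b * Real.log σ))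
            ((c - (k : ℝ)) * s ^ (c - (k : ℝ) - 1) * g (b * Real.log s) +
              s ^ (c - (k : ℝ)) * (deriv g (b * Real.log s) * (b * s⁻¹))) s := d1.mul d2
        rw [iteratedDeriv_succ, heq.deriv_eq, d3.deriv]
        have e2 : s ^ (c - (k : ℝ)) = s ^ (c - (k : ℝ) - 1) * s := by
          rw [Real.rpow_sub_one hs0.ne']
          field_simp
        rw [show (c - ((k + 1 : ℕ) : ℝ)) = c - (k : ℝ) - 1 by push_cast; ring, e2]
        field_simp
        ring
  obtain ⟨g, -, hgb, hfo⟩ := key k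
  obtain ⟨C, hC⟩ := hgb 0
  refine ⟨C, fun s hs => ?_⟩
  have hs0 : 0 < s := hs₀.trans hs
  rw [hfo s hs, abs_mul, abs_of_pos (Real.rpow_pos_of_pos hs0 _)]
  have h0 : |g (b * Real.log s)| ≤ C * wt (b * Real.log s) := by simpa using hC _ (hlog s hs)
  calc s ^ (c - ↑k) * |g (b * Real.log s)| ≤ s ^ (c - ↑k) * (C * wt (b * Real.log s)) :=
        mul_le_mul_of_nonneg_left h0 (Real.rpow_nonneg hs0.le _)
    _ = C * s ^ (c - ↑k) * wt (b * Real.log s) := by ring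

end RpowLogWeight

/-! ### The orbit of the profile near `P_∞`: the star node -/

section Orbit

variable {r : ℝ} {U S : ℝ → ℝ}

/-- The quadratic remainder of the first component of the autonomous field at `P_∞`: for
`|u|, |s| ≤ 1/4` and `1 ≤ r ≤ 2`, `|Δ·(W₁ + r u)| ≤ 4(u² + s²)`. [folklore] -/
theorem logField_fst_quad {u s r : ℝ} (hu : |u| ≤ 1 / 4) (_hs : |s| ≤ 1 / 4) (hr1 : 1 ≤ r)
    (hr2 : r ≤ 2) :
    |-(1 / 3) * s ^ 2 + 1 / 3 * r * s ^ 2 + 1 / 3 * u * s ^ 2 - 1 / 9 * r * u * s ^ 2 - u ^ 2 +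
        r * u ^ 2 - u ^ 3 + r * u ^ 3| ≤ 4 * (u ^ 2 + s ^ 2) := by
  rw [abs_le] at hu ⊢
  constructor <;> nlinarith [sq_nonneg u, sq_nonneg s, mul_nonneg (sq_nonneg u) (sq_nonneg s),
    mul_nonneg (sq_nonneg s) (by linarith : (0:ℝ) ≤ 1/4 - u),
    mul_nonneg (sq_nonneg s) (by linarith : (0:ℝ) ≤ 1/4 + u),
    mul_nonneg (sq_nonneg u) (by linarith : (0:ℝ) ≤ 1/4 - u),
    mul_nonneg (sq_nonneg u) (by linarith : (0:ℝ) ≤ 1/4 + u),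
    mul_nonneg (mul_nonneg (sq_nonneg s) (by linarith : (0:ℝ) ≤ 1/4 - u)) (by linarith : (0:ℝ) ≤ r - 1),
    mul_nonneg (mul_nonneg (sq_nonneg s) (by linarith : (0:ℝ) ≤ 1/4 + u)) (by linarith : (0:ℝ) ≤ r - 1),
    mul_nonneg (mul_nonneg (sq_nonneg u) (by linarith : (0:ℝ) ≤ 1/4 - u)) (by linarith : (0:ℝ) ≤ r - 1),
    mul_nonneg (mul_nonneg (sq_nonneg u) (by linarith : (0:ℝ) ≤ 1/4 + u)) (by linarith : (0:ℝ) ≤ r - 1),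
    mul_nonneg (mul_nonneg (sq_nonneg s) (by linarith : (0:ℝ) ≤ 1/4 - u)) (by linarith : (0:ℝ) ≤ 2 - r),
    mul_nonneg (mul_nonneg (sq_nonneg s) (by linarith : (0:ℝ) ≤ 1/4 + u)) (by linarith : (0:ℝ) ≤ 2 - r),
    mul_nonneg (mul_nonneg (sq_nonneg u) (by linarith : (0:ℝ) ≤ 1/4 - u)) (by linarith : (0:ℝ) ≤ 2 - r),
    mul_nonneg (mul_nonneg (sq_nonneg u) (by linarith : (0:ℝ) ≤ 1/4 + u)) (by linarith : (0:ℝ) ≤ 2 - r),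
    mul_nonneg (sq_nonneg u) (by linarith : (0:ℝ) ≤ r - 1), mul_nonneg (sq_nonneg s) (by linarith : (0:ℝ) ≤ r - 1),
    mul_nonneg (sq_nonneg u) (by linarith : (0:ℝ) ≤ 2 - r), mul_nonneg (sq_nonneg s) (by linarith : (0:ℝ) ≤ 2 - r)]

/-- The quadratic remainder of the second component of the autonomous field at `P_∞`: for
`|u|, |s| ≤ 1/4` and `1 ≤ r ≤ 2`, `|Δ·(W₂ + r s)| ≤ 4(u² + s²)`. [folklore] -/
theorem logField_snd_quad {u s r : ℝ} (_hu : |u| ≤ 1 / 4) (hs : |s| ≤ 1 / 4) (hr1 : 1 ≤ r)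
    (hr2 : r ≤ 2) :
    |1 / 9 * s ^ 3 - 1 / 9 * r * s ^ 3 - 2 * u * s + 4 / 3 * r * u * s - 5 / 3 * u ^ 2 * s +
        r * u ^ 2 * s| ≤ 4 * (u ^ 2 + s ^ 2) := by
  rw [abs_le] at hs ⊢
  constructor <;> nlinarith [sq_nonneg u, sq_nonneg s, sq_nonneg (u + s), sq_nonneg (u - s),
    mul_nonneg (sq_nonneg s) (by linarith : (0:ℝ) ≤ 1/4 - s),
    mul_nonneg (sq_nonneg s) (by linarith : (0:ℝ) ≤ 1/4 + s),
    mul_nonneg (sq_nonneg u) (by linarith : (0:ℝ) ≤ 1/4 - s),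
    mul_nonneg (sq_nonneg u) (by linarith : (0:ℝ) ≤ 1/4 + s),
    mul_nonneg (mul_nonneg (sq_nonneg s) (by linarith : (0:ℝ) ≤ 1/4 - s)) (by linarith : (0:ℝ) ≤ r - 1),
    mul_nonneg (mul_nonneg (sq_nonneg s) (by linarith : (0:ℝ) ≤ 1/4 + s)) (by linarith : (0:ℝ) ≤ r - 1),
    mul_nonneg (mul_nonneg (sq_nonneg u) (by linarith : (0:ℝ) ≤ 1/4 - s)) (by linarith : (0:ℝ) ≤ r - 1),
    mul_nonneg (mul_nonneg (sq_nonneg u) (by linarith : (0:ℝ) ≤ 1/4 + s)) (by linarith : (0:ℝ) ≤ r - 1),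
    mul_nonneg (mul_nonneg (sq_nonneg s) (by linarith : (0:ℝ) ≤ 1/4 - s)) (by linarith : (0:ℝ) ≤ 2 - r),
    mul_nonneg (mul_nonneg (sq_nonneg s) (by linarith : (0:ℝ) ≤ 1/4 + s)) (by linarith : (0:ℝ) ≤ 2 - r),
    mul_nonneg (mul_nonneg (sq_nonneg u) (by linarith : (0:ℝ) ≤ 1/4 - s)) (by linarith : (0:ℝ) ≤ 2 - r),
    mul_nonneg (mul_nonneg (sq_nonneg u) (by linarith : (0:ℝ) ≤ 1/4 + s)) (by linarith : (0:ℝ) ≤ 2 - r),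
    mul_nonneg (sq_nonneg (u+s)) (by linarith : (0:ℝ) ≤ 2 - r),
    mul_nonneg (sq_nonneg (u-s)) (by linarith : (0:ℝ) ≤ 2 - r),
    mul_nonneg (sq_nonneg (u-s)) (by linarith : (0:ℝ) ≤ r - 1),
    mul_nonneg (sq_nonneg (u+s)) (by linarith : (0:ℝ) ≤ r - 1)]

/-- **The orbit of the profile near `P_∞` (packaged).** For profiles as in the vendored fact with
`1 ≤ r ≤ 2` there are an open set `O ⊇ B̄(0, ¼)` of `ℝ²`, a vector field `W` smooth on `O`
with `W(0) = 0` and `‖W(w) + r w‖ ≤ 16 ‖w‖²` on `B̄(0, ¼)` (so `P_∞ = 0` is a star node,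
linearisation `−r·Id`), and `a` such that for `ξ > a` the point `(𝒰(ξ), 𝒮(ξ))`,
`𝒰(ξ) = e^{−ξ}U(e^ξ)`, `𝒮(ξ) = e^{−ξ}S(e^ξ)`, lies in `B̄(0, ¼)` and solves `y′ = W(y)`.
[cite: BuckmasterCaolaboraGomezserrano2025, Thm 1.1 p. 4 (`P_∞`)]
[cite: CaolaboraEtAl2025, §1.3 p. 5, profile equations] -/
theorem logOrbit_package (hr1 : 1 ≤ r) (hr2 : r ≤ 2)
    (hU : ContDiff ℝ ∞ fun y : V3 => (U ‖y‖ / ‖y‖) • y) (hS : ContDiff ℝ ∞ fun y : V3 => S ‖y‖)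
    (hode : ∀ ζ : ℝ, 0 < ζ →
      (r - 1) * U ζ + (ζ + U ζ) * deriv U ζ + 1 / 3 * S ζ * deriv S ζ = 0 ∧
      (r - 1) * S ζ + (ζ + U ζ) * deriv S ζ + 1 / 3 * S ζ * (deriv U ζ + 2 * U ζ / ζ) = 0)
    (hlimU : Tendsto (fun ζ => U ζ / ζ) atTop (𝓝 0))
    (hlimS : Tendsto (fun ζ => S ζ / ζ) atTop (𝓝 0)) :
    ∃ (W : ℝ × ℝ → ℝ × ℝ) (O : Set (ℝ × ℝ)) (a : ℝ), IsOpen O ∧ ContDiffOn ℝ ∞ W O ∧ W 0 = 0 ∧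
      closedBall (0 : ℝ × ℝ) (1 / 4) ⊆ O ∧
      (∀ w ∈ closedBall (0 : ℝ × ℝ) (1 / 4), ‖W w + r • w‖ ≤ 16 * ‖w‖ ^ 2) ∧
      ∀ ξ, a < ξ → (Real.exp (-ξ) * U (Real.exp ξ), Real.exp (-ξ) * S (Real.exp ξ)) ∈
          closedBall (0 : ℝ × ℝ) (1 / 4) ∧
        HasDerivAt (fun ξ => (Real.exp (-ξ) * U (Real.exp ξ), Real.exp (-ξ) * S (Real.exp ξ)))
          (W (Real.exp (-ξ) * U (Real.exp ξ), Real.exp (-ξ) * S (Real.exp ξ))) ξ := by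
  have hUc : ∀ ζ : ℝ, 0 < ζ → ContDiffAt ℝ ∞ U ζ := fun ζ hζ => contDiffAt_profile_of_radialField hU hζ
  have hSc : ∀ ζ : ℝ, 0 < ζ → ContDiffAt ℝ ∞ S ζ := fun ζ hζ => contDiffAt_profile_of_radialScalar hS hζ
  set 𝒰 : ℝ → ℝ := fun ξ => Real.exp (-ξ) * U (Real.exp ξ) with h𝒰
  set 𝒮 : ℝ → ℝ := fun ξ => Real.exp (-ξ) * S (Real.exp ξ) with h𝒮
  have hU𝒰 : ∀ ξ, U (Real.exp ξ) = Real.exp ξ * 𝒰 ξ := fun ξ => by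
    simp only [h𝒰, Real.exp_neg]
    field_simp
  have hS𝒮 : ∀ ξ, S (Real.exp ξ) = Real.exp ξ * 𝒮 ξ := fun ξ => by
    simp only [h𝒮, Real.exp_neg]
    field_simp
  have hl𝒰 : Tendsto 𝒰 atTop (𝓝 0) := by
    refine (hlimU.comp Real.tendsto_exp_atTop).congr fun ξ => ?_
    simp only [Function.comp_apply, h𝒰, Real.exp_neg, div_eq_inv_mul]
  have hl𝒮 : Tendsto 𝒮 atTop (𝓝 0) := by
    refine (hlimS.comp Real.tendsto_exp_atTop).congr fun ξ => ?_
    simp only [Function.comp_apply, h𝒮, Real.exp_neg, div_eq_inv_mul]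
  obtain ⟨a, ha⟩ : ∃ a, ∀ ξ, a ≤ ξ → |𝒰 ξ| < 1 / 4 ∧ |𝒮 ξ| < 1 / 4 := by
    have e1 := Metric.tendsto_nhds.1 hl𝒰 (1 / 4) (by norm_num)
    have e2 := Metric.tendsto_nhds.1 hl𝒮 (1 / 4) (by norm_num)
    obtain ⟨a, ha⟩ := eventually_atTop.1 (e1.and e2)
    exact ⟨a, fun ξ hξ => by simpa [Real.dist_eq] using ha ξ hξ⟩
  -- the field and its domain
  set W : ℝ × ℝ → ℝ × ℝ := fun w =>
    (((1 + w.1) * (-(r - 1) * w.1 - (1 + w.1) * w.1 - w.2 ^ 2 / 3) -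
        w.2 / 3 * (-(r - 1) * w.2 - (1 + w.1) * w.2 - w.2 * w.1)) /
        ((1 + w.1) ^ 2 - (w.2 / 3) ^ 2),
      ((1 + w.1) * (-(r - 1) * w.2 - (1 + w.1) * w.2 - w.2 * w.1) -
        w.2 / 3 * (-(r - 1) * w.1 - (1 + w.1) * w.1 - w.2 ^ 2 / 3)) /
        ((1 + w.1) ^ 2 - (w.2 / 3) ^ 2)) with hWdef
  set O : Set (ℝ × ℝ) := {w | (1 + w.1) ^ 2 - (w.2 / 3) ^ 2 ≠ 0} with hO
  have hOo : IsOpen O := isOpen_ne_fun (by fun_prop) continuous_const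
  have hWs : ContDiffOn ℝ ∞ W O := by
    have hΔ : ContDiffOn ℝ ∞ (fun w : ℝ × ℝ => (1 + w.1) ^ 2 - (w.2 / 3) ^ 2) O := by fun_prop
    have hn1 : ContDiffOn ℝ ∞ (fun w : ℝ × ℝ =>
        (1 + w.1) * (-(r - 1) * w.1 - (1 + w.1) * w.1 - w.2 ^ 2 / 3) -
          w.2 / 3 * (-(r - 1) * w.2 - (1 + w.1) * w.2 - w.2 * w.1)) O := by fun_prop
    have hn2 : ContDiffOn ℝ ∞ (fun w : ℝ × ℝ =>
        (1 + w.1) * (-(r - 1) * w.2 - (1 + w.1) * w.2 - w.2 * w.1) -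
          w.2 / 3 * (-(r - 1) * w.1 - (1 + w.1) * w.1 - w.2 ^ 2 / 3)) O := by fun_prop
    exact (hn1.div hΔ fun w hw => hw).prodMk (hn2.div hΔ fun w hw => hw)
  have hW0 : W 0 = 0 := by
    simp [hWdef]
  -- the ball `B̄(0, 1/4)`: coordinates, determinant
  have hball : ∀ w ∈ closedBall (0 : ℝ × ℝ) (1 / 4), |w.1| ≤ 1 / 4 ∧ |w.2| ≤ 1 / 4 := by
    intro w hw
    have hw' : ‖w‖ ≤ 1 / 4 := by simpa using hw
    exact ⟨(norm_fst_le w).trans hw', (norm_snd_le w).trans hw'⟩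
  have hΔ : ∀ w ∈ closedBall (0 : ℝ × ℝ) (1 / 4), 1 / 2 ≤ (1 + w.1) ^ 2 - (w.2 / 3) ^ 2 := by
    intro w hw
    obtain ⟨h1, h2⟩ := hball w hw
    rw [abs_le] at h1 h2
    nlinarith
  have hKO : closedBall (0 : ℝ × ℝ) (1 / 4) ⊆ O := fun w hw => by
    show (1 + w.1) ^ 2 - (w.2 / 3) ^ 2 ≠ 0
    linarith [hΔ w hw]
  -- the star node: `‖W w + r w‖ ≤ 16 ‖w‖²`
  have hquad : ∀ w ∈ closedBall (0 : ℝ × ℝ) (1 / 4), ‖W w + r • w‖ ≤ 16 * ‖w‖ ^ 2 := by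
    intro w hw
    obtain ⟨h1, h2⟩ := hball w hw
    have hD := hΔ w hw
    have hD0 : (1 + w.1) ^ 2 - (w.2 / 3) ^ 2 ≠ 0 := by linarith
    have hE : w.1 ^ 2 + w.2 ^ 2 ≤ 2 * ‖w‖ ^ 2 := by
      have e1 : w.1 ^ 2 ≤ ‖w‖ ^ 2 := by
        rw [← sq_abs]; exact pow_le_pow_left₀ (abs_nonneg _) (norm_fst_le w) 2
      have e2 : w.2 ^ 2 ≤ ‖w‖ ^ 2 := by
        rw [← sq_abs]; exact pow_le_pow_left₀ (abs_nonneg _) (norm_snd_le w) 2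
      linarith
    have c1 : |(W w + r • w).1| ≤ 16 * ‖w‖ ^ 2 := by
      have e : (W w + r • w).1 =
          (-(1 / 3) * w.2 ^ 2 + 1 / 3 * r * w.2 ^ 2 + 1 / 3 * w.1 * w.2 ^ 2 -
            1 / 9 * r * w.1 * w.2 ^ 2 - w.1 ^ 2 + r * w.1 ^ 2 - w.1 ^ 3 + r * w.1 ^ 3) /
            ((1 + w.1) ^ 2 - (w.2 / 3) ^ 2) := by
        have hA : (W w + r • w).1 =
            ((1 + w.1) * (-(r - 1) * w.1 - (1 + w.1) * w.1 - w.2 ^ 2 / 3) -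
              w.2 / 3 * (-(r - 1) * w.2 - (1 + w.1) * w.2 - w.2 * w.1)) /
              ((1 + w.1) ^ 2 - (w.2 / 3) ^ 2) + r * w.1 := by
          simp only [hWdef, Prod.fst_add, Prod.smul_fst, smul_eq_mul]
        rw [hA, div_add' _ _ _ hD0]
        congr 1
        ring
      rw [e, abs_div, abs_of_pos (show (0 : ℝ) < (1 + w.1) ^ 2 - (w.2 / 3) ^ 2 by linarith)]
      rw [div_le_iff₀ (show (0 : ℝ) < (1 + w.1) ^ 2 - (w.2 / 3) ^ 2 by linarith)]
      have hq := logField_fst_quad (r := r) h1 h2 hr1 hr2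
      nlinarith [sq_nonneg ‖w‖, mul_nonneg (sub_nonneg.2 hD) (sq_nonneg ‖w‖)]
    have c2 : |(W w + r • w).2| ≤ 16 * ‖w‖ ^ 2 := by
      have e : (W w + r • w).2 =
          (1 / 9 * w.2 ^ 3 - 1 / 9 * r * w.2 ^ 3 - 2 * w.1 * w.2 + 4 / 3 * r * w.1 * w.2 -
            5 / 3 * w.1 ^ 2 * w.2 + r * w.1 ^ 2 * w.2) / ((1 + w.1) ^ 2 - (w.2 / 3) ^ 2) := by
        have hA : (W w + r • w).2 =
            ((1 + w.1) * (-(r - 1) * w.2 - (1 + w.1) * w.2 - w.2 * w.1) -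
              w.2 / 3 * (-(r - 1) * w.1 - (1 + w.1) * w.1 - w.2 ^ 2 / 3)) /
              ((1 + w.1) ^ 2 - (w.2 / 3) ^ 2) + r * w.2 := by
          simp only [hWdef, Prod.snd_add, Prod.smul_snd, smul_eq_mul]
        rw [hA, div_add' _ _ _ hD0]
        congr 1
        ring
      rw [e, abs_div, abs_of_pos (show (0 : ℝ) < (1 + w.1) ^ 2 - (w.2 / 3) ^ 2 by linarith)]
      rw [div_le_iff₀ (show (0 : ℝ) < (1 + w.1) ^ 2 - (w.2 / 3) ^ 2 by linarith)]
      have hq := logField_snd_quad (r := r) h1 h2 hr1 hr2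
      nlinarith [sq_nonneg ‖w‖, mul_nonneg (sub_nonneg.2 hD) (sq_nonneg ‖w‖)]
    rw [Prod.norm_def, Real.norm_eq_abs, Real.norm_eq_abs]
    exact max_le c1 c2
  -- the orbit
  refine ⟨W, O, a, hOo, hWs, hW0, hKO, hquad, fun ξ hξ => ⟨?_, ?_⟩⟩
  · have h := ha ξ hξ.le
    simp only [mem_closedBall, dist_zero_right, Prod.norm_def, Real.norm_eq_abs]
    exact max_le h.1.le h.2.le
  · have hmem : (𝒰 ξ, 𝒮 ξ) ∈ closedBall (0 : ℝ × ℝ) (1 / 4) := by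
      have h := ha ξ hξ.le
      simp only [mem_closedBall, dist_zero_right, Prod.norm_def, Real.norm_eq_abs]
      exact max_le h.1.le h.2.le
    have hΔ' : (1 + 𝒰 ξ) ^ 2 - (𝒮 ξ / 3) ^ 2 ≠ 0 := hKO hmem
    have d𝒰 := hasDerivAt_logProfile hUc ξ
    have d𝒮 := hasDerivAt_logProfile hSc ξ
    set p : ℝ := -(Real.exp (-ξ) * U (Real.exp ξ)) + deriv U (Real.exp ξ) with hp
    set q : ℝ := -(Real.exp (-ξ) * S (Real.exp ξ)) + deriv S (Real.exp ξ) with hq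
    have hUp : deriv U (Real.exp ξ) = 𝒰 ξ + p := by simp only [hp, h𝒰]; ring
    have hSq : deriv S (Real.exp ξ) = 𝒮 ξ + q := by simp only [hq, h𝒮]; ring
    have hζ := Real.exp_pos ξ
    obtain ⟨E1, E2⟩ := hode _ hζ
    rw [hU𝒰, hS𝒮, hUp, hSq] at E1 E2
    have hdiv : 2 * (Real.exp ξ * 𝒰 ξ) / Real.exp ξ = 2 * 𝒰 ξ := by field_simp
    rw [hdiv] at E2
    have L1 : (r - 1) * 𝒰 ξ + (1 + 𝒰 ξ) * (𝒰 ξ + p) + 1 / 3 * 𝒮 ξ * (𝒮 ξ + q) = 0 := by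
      have h0 : Real.exp ξ * ((r - 1) * 𝒰 ξ + (1 + 𝒰 ξ) * (𝒰 ξ + p) +
          1 / 3 * 𝒮 ξ * (𝒮 ξ + q)) = 0 := by rw [← E1]; ring
      exact (mul_eq_zero.1 h0).resolve_left hζ.ne'
    have L2 : (r - 1) * 𝒮 ξ + (1 + 𝒰 ξ) * (𝒮 ξ + q) +
        1 / 3 * 𝒮 ξ * (𝒰 ξ + p + 2 * 𝒰 ξ) = 0 := by
      have h0 : Real.exp ξ * ((r - 1) * 𝒮 ξ + (1 + 𝒰 ξ) * (𝒮 ξ + q) +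
          1 / 3 * 𝒮 ξ * (𝒰 ξ + p + 2 * 𝒰 ξ)) = 0 := by rw [← E2]; ring
      exact (mul_eq_zero.1 h0).resolve_left hζ.ne'
    obtain ⟨hp', hq'⟩ := logVar_solve L1 L2 hΔ'
    have hWy : W (𝒰 ξ, 𝒮 ξ) = (p, q) := by
      simp only [hWdef]
      rw [hp', hq']
    rw [hWy]
    exact d𝒰.prodMk d𝒮

/-- **Sharp decay of the orbit: `(𝒰, 𝒮)(ξ) = O(e^{−rξ})`.** For `1 < r < 2`: the crude bound
`|𝒰|, |𝒮| ≤ M e^{−ξ}` (`U`, `S` bounded, `exists_bound_profile`) bootstraps through the star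
node (`z = e^{rξ}(𝒰, 𝒮)` has `‖z′‖ ≤ 16M² e^{(r−2)ξ}`, integrable) to `|𝒰(ξ)|, |𝒮(ξ)| ≤ C e^{−rξ}`,
i.e. `|U(ζ)|, |S(ζ)| ≤ C ζ^{1−r}` — the case `j = 0` of eq. (1.6) of the source.
[cite: CaolaboraEtAl2025, eq. (1.6) p. 6] -/
theorem logProfile_sharp (hr1 : 1 < r) (hr2 : r < 2)
    (hU : ContDiff ℝ ∞ fun y : V3 => (U ‖y‖ / ‖y‖) • y) (hS : ContDiff ℝ ∞ fun y : V3 => S ‖y‖)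
    (hode : ∀ ζ : ℝ, 0 < ζ →
      (r - 1) * U ζ + (ζ + U ζ) * deriv U ζ + 1 / 3 * S ζ * deriv S ζ = 0 ∧
      (r - 1) * S ζ + (ζ + U ζ) * deriv S ζ + 1 / 3 * S ζ * (deriv U ζ + 2 * U ζ / ζ) = 0)
    (hlimU : Tendsto (fun ζ => U ζ / ζ) atTop (𝓝 0))
    (hlimS : Tendsto (fun ζ => S ζ / ζ) atTop (𝓝 0)) :
    ∃ a C : ℝ, ∀ ξ, a < ξ →
      ‖(Real.exp (-ξ) * U (Real.exp ξ), Real.exp (-ξ) * S (Real.exp ξ))‖ ≤ C * Real.exp (-r * ξ) := by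
  obtain ⟨W, O, a, hOo, hWs, hW0, hKO, hquad, horb⟩ :=
    logOrbit_package hr1.le hr2.le hU hS hode hlimU hlimS
  obtain ⟨M, hM0, hM⟩ := exists_bound_profile hr1 hU hS hode hlimU hlimS
  set y : ℝ → ℝ × ℝ := fun ξ => (Real.exp (-ξ) * U (Real.exp ξ), Real.exp (-ξ) * S (Real.exp ξ))
    with hy
  -- the crude bound `‖y ξ‖ ≤ M e^{-ξ}`
  have hcrude : ∀ ξ, ‖y ξ‖ ≤ M * Real.exp (-ξ) := by
    intro ξ
    have hζ := Real.exp_pos ξ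
    have h1 : |U (Real.exp ξ)| ≤ M := by
      have h := (hM (Real.exp ξ • (EuclideanSpace.single 0 1 : V3))).1
      rwa [radialField_ray U hζ, norm_smul, PiLp.norm_single, norm_one, mul_one,
        Real.norm_eq_abs] at h
    have h2 : |S (Real.exp ξ)| ≤ M := by
      have h := (hM (Real.exp ξ • (EuclideanSpace.single 0 1 : V3))).2
      rwa [norm_smul_e0 hζ] at h
    have he : 0 < Real.exp (-ξ) := Real.exp_pos _
    simp only [hy, Prod.norm_def, Real.norm_eq_abs, abs_mul, abs_of_pos he]
    rw [max_le_iff]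
    constructor <;> nlinarith
  -- the bootstrap: `z = e^{rξ} y`
  set z : ℝ → ℝ × ℝ := fun ξ => Real.exp (r * ξ) • y ξ with hz
  have hz' : ∀ ξ, a < ξ → HasDerivAt z (Real.exp (r * ξ) • (W (y ξ) + r • y ξ)) ξ := by
    intro ξ hξ
    have h1 : HasDerivAt (fun ξ => Real.exp (r * ξ)) (Real.exp (r * ξ) * r) ξ := by
      simpa using ((hasDerivAt_id ξ).const_mul r).exp
    have h2 := (horb ξ hξ).2
    have h3 := h1.smul h2
    refine h3.congr_deriv ?_
    rw [smul_add, smul_smul, add_comm]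
  have hzb : ∀ ξ, a < ξ → ‖Real.exp (r * ξ) • (W (y ξ) + r • y ξ)‖ ≤
      16 * M ^ 2 * Real.exp ((r - 2) * ξ) := by
    intro ξ hξ
    rw [norm_smul, Real.norm_eq_abs, abs_of_pos (Real.exp_pos _)]
    have h1 := hquad (y ξ) (horb ξ hξ).1
    have h2 : ‖y ξ‖ ^ 2 ≤ (M * Real.exp (-ξ)) ^ 2 :=
      pow_le_pow_left₀ (norm_nonneg _) (hcrude ξ) 2
    calc Real.exp (r * ξ) * ‖W (y ξ) + r • y ξ‖
        ≤ Real.exp (r * ξ) * (16 * (M * Real.exp (-ξ)) ^ 2) := by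
          refine mul_le_mul_of_nonneg_left (h1.trans ?_) (Real.exp_pos _).le
          linarith
      _ = 16 * M ^ 2 * Real.exp ((r - 2) * ξ) := by
          rw [mul_pow, ← Real.exp_nat_mul, show ((2 : ℕ) : ℝ) * -ξ = -2 * ξ by push_cast; ring]
          rw [show (r - 2) * ξ = r * ξ + -2 * ξ by ring, Real.exp_add]
          ring
  -- fencing on `[a + 1, ξ₁]`
  set ξ₀ : ℝ := a + 1 with hξ₀
  set c : ℝ := 16 * M ^ 2 with hc
  have h2r : 0 < 2 - r := by linarith
  set B : ℝ → ℝ := fun x => ‖z ξ₀‖ + c / (2 - r) * (Real.exp ((r - 2) * ξ₀) - Real.exp ((r - 2) * x))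
    with hB
  have hB' : ∀ x, HasDerivAt B (c * Real.exp ((r - 2) * x)) x := by
    intro x
    have h1 : HasDerivAt (fun x => Real.exp ((r - 2) * x)) (Real.exp ((r - 2) * x) * (r - 2)) x := by
      simpa using ((hasDerivAt_id x).const_mul (r - 2)).exp
    have h2 := ((h1.const_sub (Real.exp ((r - 2) * ξ₀))).const_mul (c / (2 - r))).const_add ‖z ξ₀‖
    refine h2.congr_deriv ?_
    field_simp
    ring
  have hzcont : ∀ ξ₁, ContinuousOn z (Icc ξ₀ ξ₁) := by
    intro ξ₁ x hx
    exact (hz' x (by rw [hξ₀] at hx; linarith [hx.1])).continuousAt.continuousWithinAt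
  have hbound : ∀ ξ, ξ₀ ≤ ξ → ‖z ξ‖ ≤ ‖z ξ₀‖ + c / (2 - r) * Real.exp ((r - 2) * ξ₀) := by
    intro ξ hξ
    have key := image_norm_le_of_norm_deriv_right_le_deriv_boundary (f := z) (a := ξ₀) (b := ξ)
      (f' := fun x => Real.exp (r * x) • (W (y x) + r • y x)) (hzcont ξ)
      (fun x hx => (hz' x (by rw [hξ₀] at hx; linarith [hx.1])).hasDerivWithinAt)
      (B := B) (B' := fun x => c * Real.exp ((r - 2) * x)) (by simp [hB]) hB'
      (fun x hx => hzb x (by rw [hξ₀] at hx; linarith [hx.1])) (right_mem_Icc.2 hξ)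
    refine key.trans ?_
    simp only [hB]
    have : 0 ≤ c / (2 - r) * Real.exp ((r - 2) * ξ) := by positivity
    linarith
  -- conclusion
  set C : ℝ := ‖z ξ₀‖ + c / (2 - r) * Real.exp ((r - 2) * ξ₀) with hC
  refine ⟨ξ₀, C, fun ξ hξ => ?_⟩
  have h1 := hbound ξ hξ.le
  have h2 : y ξ = Real.exp (-r * ξ) • z ξ := by
    simp only [hz, smul_smul]
    rw [← Real.exp_add, show -r * ξ + r * ξ = 0 by ring, Real.exp_zero, one_smul]
  show ‖y ξ‖ ≤ C * Real.exp (-r * ξ)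
  rw [h2, norm_smul, Real.norm_eq_abs, abs_of_pos (Real.exp_pos _), mul_comm]
  exact mul_le_mul_of_nonneg_right h1 (Real.exp_pos _).le

/-- **Sharp decay of all derivatives of the orbit: `(𝒰, 𝒮)^{(k)}(ξ) = O(e^{−rξ})`.**
[cite: CaolaboraEtAl2025, eq. (1.6) p. 6] -/
theorem iteratedDeriv_logProfile_sharp (hr1 : 1 < r) (hr2 : r < 2)
    (hU : ContDiff ℝ ∞ fun y : V3 => (U ‖y‖ / ‖y‖) • y) (hS : ContDiff ℝ ∞ fun y : V3 => S ‖y‖)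
    (hode : ∀ ζ : ℝ, 0 < ζ →
      (r - 1) * U ζ + (ζ + U ζ) * deriv U ζ + 1 / 3 * S ζ * deriv S ζ = 0 ∧
      (r - 1) * S ζ + (ζ + U ζ) * deriv S ζ + 1 / 3 * S ζ * (deriv U ζ + 2 * U ζ / ζ) = 0)
    (hlimU : Tendsto (fun ζ => U ζ / ζ) atTop (𝓝 0))
    (hlimS : Tendsto (fun ζ => S ζ / ζ) atTop (𝓝 0)) :
    ∃ a : ℝ, ∀ k : ℕ, ∃ C, ∀ ξ, a < ξ →
      |iteratedDeriv k (fun ξ => Real.exp (-ξ) * U (Real.exp ξ)) ξ| ≤ C * Real.exp (-r * ξ) ∧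
        |iteratedDeriv k (fun ξ => Real.exp (-ξ) * S (Real.exp ξ)) ξ| ≤ C * Real.exp (-r * ξ) := by
  obtain ⟨W, O, a, hOo, hWs, hW0, hKO, -, horb⟩ :=
    logOrbit_package hr1.le hr2.le hU hS hode hlimU hlimS
  obtain ⟨a', C', hC'⟩ := logProfile_sharp hr1 hr2 hU hS hode hlimU hlimS
  have hUc : ∀ ζ : ℝ, 0 < ζ → ContDiffAt ℝ ∞ U ζ := fun ζ hζ => contDiffAt_profile_of_radialField hU hζ
  have hSc : ∀ ζ : ℝ, 0 < ζ → ContDiffAt ℝ ∞ S ζ := fun ζ hζ => contDiffAt_profile_of_radialScalar hS hζ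
  set b : ℝ := max a a' with hb
  refine ⟨b, fun k => ?_⟩
  obtain ⟨L, hL⟩ := exists_lipschitz_iteratedDeriv_of_flow hOo hWs hW0 (isCompact_closedBall _ _)
    (convex_closedBall _ _) hKO (mem_closedBall_self (by norm_num))
    (fun ξ hξ => (horb ξ ((le_max_left _ _).trans_lt hξ)).2)
    (fun ξ hξ => (horb ξ ((le_max_left _ _).trans_lt hξ)).1) k
  refine ⟨|L| * C', fun ξ hξ => ?_⟩
  have h1 := hL ξ hξ
  have h2 := hC' ξ ((le_max_right _ _).trans_lt hξ)
  have h3 : ‖iteratedDeriv k (fun ξ => (Real.exp (-ξ) * U (Real.exp ξ),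
      Real.exp (-ξ) * S (Real.exp ξ))) ξ‖ ≤ |L| * C' * Real.exp (-r * ξ) := by
    calc _ ≤ L * ‖(Real.exp (-ξ) * U (Real.exp ξ), Real.exp (-ξ) * S (Real.exp ξ))‖ := h1
      _ ≤ |L| * ‖(Real.exp (-ξ) * U (Real.exp ξ), Real.exp (-ξ) * S (Real.exp ξ))‖ :=
          mul_le_mul_of_nonneg_right (le_abs_self L) (norm_nonneg _)
      _ ≤ |L| * (C' * Real.exp (-r * ξ)) := mul_le_mul_of_nonneg_left h2 (abs_nonneg L)
      _ = |L| * C' * Real.exp (-r * ξ) := by ring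
  rw [iteratedDeriv_prodMk (contDiff_logProfile hUc) (contDiff_logProfile hSc) k] at h3
  simp only [Prod.norm_def, Real.norm_eq_abs, max_le_iff] at h3
  exact h3

/-- **Sharp far-field asymptotics of the profile, radial form of eq. (1.6):** for `1 < r < 2`
and every `k` there are `ζ₀ > 0`, `C` with `|U^{(k)}(ζ)| ≤ C ζ^{1−r−k}`,
`|S^{(k)}(ζ)| ≤ C ζ^{1−r−k}` for `ζ ≥ ζ₀`. [cite: CaolaboraEtAl2025, eq. (1.6) p. 6]
[cite: BuckmasterCaolaboraGomezserrano2025, Thm 1.1 p. 4] -/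
theorem iteratedDeriv_profile_sharp (hr1 : 1 < r) (hr2 : r < 2)
    (hU : ContDiff ℝ ∞ fun y : V3 => (U ‖y‖ / ‖y‖) • y) (hS : ContDiff ℝ ∞ fun y : V3 => S ‖y‖)
    (hode : ∀ ζ : ℝ, 0 < ζ →
      (r - 1) * U ζ + (ζ + U ζ) * deriv U ζ + 1 / 3 * S ζ * deriv S ζ = 0 ∧
      (r - 1) * S ζ + (ζ + U ζ) * deriv S ζ + 1 / 3 * S ζ * (deriv U ζ + 2 * U ζ / ζ) = 0)
    (hlimU : Tendsto (fun ζ => U ζ / ζ) atTop (𝓝 0))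
    (hlimS : Tendsto (fun ζ => S ζ / ζ) atTop (𝓝 0)) (k : ℕ) :
    ∃ ζ₀ C : ℝ, 0 < ζ₀ ∧ ∀ ζ, ζ₀ ≤ ζ →
      |iteratedDeriv k U ζ| ≤ C * ζ ^ (1 - r - k) ∧ |iteratedDeriv k S ζ| ≤ C * ζ ^ (1 - r - k) := by
  have hUc : ∀ ζ : ℝ, 0 < ζ → ContDiffAt ℝ ∞ U ζ := fun ζ hζ => contDiffAt_profile_of_radialField hU hζ
  have hSc : ∀ ζ : ℝ, 0 < ζ → ContDiffAt ℝ ∞ S ζ := fun ζ hζ => contDiffAt_profile_of_radialScalar hS hζ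
  obtain ⟨a, ha⟩ := iteratedDeriv_logProfile_sharp hr1 hr2 hU hS hode hlimU hlimS
  -- `U ζ = ζ^1 · 𝒰(1 · log ζ)` for `ζ > e^a`
  have hs₀ : 0 < Real.exp a := Real.exp_pos a
  have has : a ≤ 1 * Real.log (Real.exp a) := by rw [Real.log_exp]; linarith
  have hfU : ∀ ζ, Real.exp a < ζ → U ζ = ζ ^ (1 : ℝ) *
      (Real.exp (-(1 * Real.log ζ)) * U (Real.exp (1 * Real.log ζ))) := by
    intro ζ hζ
    have hζ0 : 0 < ζ := hs₀.trans hζ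
    rw [one_mul, Real.exp_neg, Real.exp_log hζ0, Real.rpow_one]
    field_simp
  have hfS : ∀ ζ, Real.exp a < ζ → S ζ = ζ ^ (1 : ℝ) *
      (Real.exp (-(1 * Real.log ζ)) * S (Real.exp (1 * Real.log ζ))) := by
    intro ζ hζ
    have hζ0 : 0 < ζ := hs₀.trans hζ
    rw [one_mul, Real.exp_neg, Real.exp_log hζ0, Real.rpow_one]
    field_simp
  obtain ⟨CU, hCU⟩ := iteratedDeriv_le_of_rpow_mul_log_weight (wt := fun η => Real.exp (-r * η))
    one_pos (contDiff_logProfile hUc) (fun m => (ha m).imp fun C hC η hη => (hC η hη).1)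
    hs₀ has hfU k
  obtain ⟨CS, hCS⟩ := iteratedDeriv_le_of_rpow_mul_log_weight (wt := fun η => Real.exp (-r * η))
    one_pos (contDiff_logProfile hSc) (fun m => (ha m).imp fun C hC η hη => (hC η hη).2)
    hs₀ has hfS k
  refine ⟨Real.exp a + 1, max CU CS, by positivity, fun ζ hζ => ?_⟩
  have hζ' : Real.exp a < ζ := by linarith
  have hζ0 : 0 < ζ := hs₀.trans hζ'
  -- `ζ^{1-k} e^{-r log ζ} = ζ^{1-r-k}`
  have hw : ζ ^ ((1 : ℝ) - k) * Real.exp (-r * (1 * Real.log ζ)) = ζ ^ (1 - r - k) := by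
    rw [one_mul, show -r * Real.log ζ = Real.log ζ * (-r) by ring, ← Real.rpow_def_of_pos hζ0,
      ← Real.rpow_add hζ0]
    ring_nf
  have hpos : 0 ≤ ζ ^ (1 - r - k) := Real.rpow_nonneg hζ0.le _
  constructor
  · have h := hCU ζ hζ'
    rw [mul_assoc, hw] at h
    exact h.trans (mul_le_mul_of_nonneg_right (le_max_left _ _) hpos)
  · have h := hCS ζ hζ'
    rw [mul_assoc, hw] at h
    exact h.trans (mul_le_mul_of_nonneg_right (le_max_right _ _) hpos)

/-- **Sharp bounds through `s = ζ²`:** for `1 < r < 2` there is `s₀ ≥ 1` beyond which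
`s ↦ S(√s)` and `s ↦ U(√s)/√s` are smooth with
`|dᵏ/dsᵏ S(√s)| ≤ C s^{(1−r)/2−k}` and `|dᵏ/dsᵏ (U(√s)/√s)| ≤ C s^{−r/2−k}` (the form of (1.6)
used for the fields on `ℝ³`, which factor through `y ↦ |y|²`). [cite: CaolaboraEtAl2025, eq. (1.6) p. 6] -/
theorem iteratedDeriv_profile_sqrt_sharp (hr1 : 1 < r) (hr2 : r < 2)
    (hU : ContDiff ℝ ∞ fun y : V3 => (U ‖y‖ / ‖y‖) • y) (hS : ContDiff ℝ ∞ fun y : V3 => S ‖y‖)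
    (hode : ∀ ζ : ℝ, 0 < ζ →
      (r - 1) * U ζ + (ζ + U ζ) * deriv U ζ + 1 / 3 * S ζ * deriv S ζ = 0 ∧
      (r - 1) * S ζ + (ζ + U ζ) * deriv S ζ + 1 / 3 * S ζ * (deriv U ζ + 2 * U ζ / ζ) = 0)
    (hlimU : Tendsto (fun ζ => U ζ / ζ) atTop (𝓝 0))
    (hlimS : Tendsto (fun ζ => S ζ / ζ) atTop (𝓝 0)) :
    ∃ s₀ : ℝ, 1 ≤ s₀ ∧
      (∀ s, s₀ < s → ContDiffAt ℝ ∞ (fun s => S (Real.sqrt s)) s) ∧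
      (∀ s, s₀ < s → ContDiffAt ℝ ∞ (fun s => U (Real.sqrt s) / Real.sqrt s) s) ∧
      (∀ k : ℕ, ∃ C, ∀ s, s₀ < s →
        |iteratedDeriv k (fun s => S (Real.sqrt s)) s| ≤ C * s ^ ((1 - r) / 2 - (k : ℝ))) ∧
      (∀ k : ℕ, ∃ C, ∀ s, s₀ < s →
        |iteratedDeriv k (fun s => U (Real.sqrt s) / Real.sqrt s) s| ≤ C * s ^ (-r / 2 - (k : ℝ))) := by
  have hUc : ∀ ζ : ℝ, 0 < ζ → ContDiffAt ℝ ∞ U ζ := fun ζ hζ => contDiffAt_profile_of_radialField hU hζ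
  have hSc : ∀ ζ : ℝ, 0 < ζ → ContDiffAt ℝ ∞ S ζ := fun ζ hζ => contDiffAt_profile_of_radialScalar hS hζ
  obtain ⟨a, ha⟩ := iteratedDeriv_logProfile_sharp hr1 hr2 hU hS hode hlimU hlimS
  set s₀ : ℝ := max 1 (Real.exp (2 * a)) with hs₀
  have hs₀1 : 1 ≤ s₀ := le_max_left _ _
  have hs₀0 : 0 < s₀ := one_pos.trans_le hs₀1
  have has : a ≤ 1 / 2 * Real.log s₀ := by
    have h1 : Real.exp (2 * a) ≤ s₀ := le_max_right _ _
    have h2 : 2 * a ≤ Real.log s₀ := by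
      rw [← Real.log_exp (2 * a)]
      exact Real.log_le_log (Real.exp_pos _) h1
    linarith
  have hSq : ∀ s, 0 < s → ContDiffAt ℝ ∞ (fun s => S (Real.sqrt s)) s := fun s hs =>
    (hSc _ (Real.sqrt_pos.2 hs)).comp s (Real.contDiffAt_sqrt hs.ne')
  have hUq : ∀ s, 0 < s → ContDiffAt ℝ ∞ (fun s => U (Real.sqrt s) / Real.sqrt s) s := fun s hs =>
    ((hUc _ (Real.sqrt_pos.2 hs)).comp s (Real.contDiffAt_sqrt hs.ne')).div
      (Real.contDiffAt_sqrt hs.ne') (Real.sqrt_pos.2 hs).ne'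
  have hlog2 : ∀ s, 0 < s → Real.exp (1 / 2 * Real.log s) = Real.sqrt s := fun s hs => by
    rw [Real.sqrt_eq_rpow, Real.rpow_def_of_pos hs]
    ring_nf
  have hfS : ∀ s, s₀ < s → S (Real.sqrt s) =
      s ^ (1 / 2 : ℝ) * (Real.exp (-(1 / 2 * Real.log s)) * S (Real.exp (1 / 2 * Real.log s))) := by
    intro s hs
    have hs0 : 0 < s := hs₀0.trans hs
    rw [hlog2 s hs0, Real.exp_neg, hlog2 s hs0, ← Real.sqrt_eq_rpow]
    field_simp [(Real.sqrt_pos.2 hs0).ne']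
  have hfU : ∀ s, s₀ < s → U (Real.sqrt s) / Real.sqrt s =
      s ^ (0 : ℝ) * (Real.exp (-(1 / 2 * Real.log s)) * U (Real.exp (1 / 2 * Real.log s))) := by
    intro s hs
    have hs0 : 0 < s := hs₀0.trans hs
    rw [hlog2 s hs0, Real.exp_neg, hlog2 s hs0, Real.rpow_zero]
    field_simp [(Real.sqrt_pos.2 hs0).ne']
  -- the weight through `s`: `e^{-r (½ log s)} = s^{-r/2}`
  have hw : ∀ s, 0 < s → Real.exp (-r * (1 / 2 * Real.log s)) = s ^ (-r / 2) := by
    intro s hs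
    rw [show -r * (1 / 2 * Real.log s) = Real.log s * (-r / 2) by ring, ← Real.rpow_def_of_pos hs]
  refine ⟨s₀, hs₀1, fun s hs => hSq s (hs₀0.trans hs), fun s hs => hUq s (hs₀0.trans hs),
    fun k => ?_, fun k => ?_⟩
  · obtain ⟨C, hC⟩ := iteratedDeriv_le_of_rpow_mul_log_weight (wt := fun η => Real.exp (-r * η))
      (by norm_num) (contDiff_logProfile hSc) (fun m => (ha m).imp fun C hC η hη => (hC η hη).2)
      hs₀0 has hfS k
    refine ⟨C, fun s hs => ?_⟩
    have hs0 : 0 < s := hs₀0.trans hs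
    have h := hC s hs
    rw [mul_assoc, hw s hs0, ← Real.rpow_add hs0] at h
    convert h using 3
    ring
  · obtain ⟨C, hC⟩ := iteratedDeriv_le_of_rpow_mul_log_weight (wt := fun η => Real.exp (-r * η))
      (by norm_num) (contDiff_logProfile hUc) (fun m => (ha m).imp fun C hC η hη => (hC η hη).1)
      hs₀0 has hfU k
    refine ⟨C, fun s hs => ?_⟩
    have hs0 : 0 < s := hs₀0.trans hs
    have h := hC s hs
    rw [mul_assoc, hw s hs0, ← Real.rpow_add hs0] at h
    convert h using 3
    ring

end Orbit

end CaolaboraEtAl2025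

end Literature.Analysis.FluidPDE
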